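import Summits.ValiantsHypothesis.ValiantsHypothesis.Theorems.LacunarySymmetroidMatrixDescartesCensusV20SoundCoeffs

/-!
# `MatrixDescartes` census — soundness of the `V = 20` certificate checker: a twenty yields a model; `V20.posRootLawOn_of_tableOK`; the box cover by slices `V20.box_of_plan`

HONEST FRAMING.  Object-search cell `pub-symmetroid`; door-A item `DoorA26 = PosRootLawAt 2 6 19`
(stmt-ValiantsHypothesis-19979; OPEN, typed, never asserted).  Part of the proof that a certificate accepted by `V20.checkCell` (`…CensusV20Check`) excludes a twenty — `20 = D(2,6)` distinct
positive det-roots of a six-term real symmetric `2 × 2` pencil — on its support (semantics: `…CensusV20Model`).  Nothing here bears on `V = 19`, on `ζ_sym(2,6)` over all supports, on `DoorA26` itself, on `MatrixDescartes`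
(stmt-ValiantsHypothesis-18050) or on `VP ≠ VNP`.

[folklore] Certificate-checker soundness / replay; elementary.
-/

-- the D-0017 layout repeats a namespace component (single-conjunct summit); the `dupNamespace` linter flags it; name mandated.
set_option linter.dupNamespace false

namespace Summit.ValiantsHypothesis.ValiantsHypothesis.Theorems.LacunarySymmetroidMatrixDescartes.Census.V20

section Main

open Polynomial Finset
open scoped BigOperators Polynomial Matrix
open Summit.ValiantsHypothesis.ValiantsHypothesis.Theorems.MatrixDescartes.Negative (PosRootLawAt)

variable {dl : List ℕ} {ord : List Atom} {S : Fin 6 → Matrix (Fin 2) (Fin 2) ℝ}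

/-! ### The model of a hypothetical twenty and the main theorems -/

/-- A hypothetical twenty on a checked support yields a model for the sign of its lowest coefficient. [folklore] -/
theorem model_of_twenty (h : ordOK dl ord = true) (hS : ∀ l, (S l).IsSymm)
    (h20 : 20 ≤ ((pdet dl S).roots.toFinset.filter (fun t => 0 < t)).card) :
    ∃ x : ℕ → ℝ, Model dl ord (decide (0 < (pdet dl S).coeff (Epos dl ord 0))) x (aval S) := by
  have hx21 : ∀ t, t < 21 → (fun u => if u < 21 then |(pdet dl S).coeff (Epos dl ord u)| else (1 : ℝ)) t
      = |(pdet dl S).coeff (Epos dl ord t)| := fun t ht => by simp [ht]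
  have hsg := sign_pattern h h20
  have hcoef : ∀ t, t < 21 → (pdet dl S).coeff (Epos dl ord t)
      = sgnR (decide (0 < (pdet dl S).coeff (Epos dl ord 0))) t * |(pdet dl S).coeff (Epos dl ord t)| := by
    intro t ht
    have h1 := hsg t ht
    have hg1 : sgnR (decide (0 < (pdet dl S).coeff (Epos dl ord 0))) t = 1 ∨
        sgnR (decide (0 < (pdet dl S).coeff (Epos dl ord 0))) t = -1 := by unfold sgnR; split_ifs <;> simp
    rcases hg1 with e | e <;> rw [e] at h1 ⊢
    · rw [one_mul] at h1; rw [one_mul, abs_of_pos h1]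
    · have : (pdet dl S).coeff (Epos dl ord t) < 0 := by linarith
      rw [abs_of_neg this]; ring
  refine ⟨fun u => if u < 21 then |(pdet dl S).coeff (Epos dl ord u)| else 1, ⟨h, ?_, ?_, ?_, ?_, ?_, ?_, ?_⟩⟩
  · intro t
    show 0 < (if t < 21 then |(pdet dl S).coeff (Epos dl ord t)| else (1 : ℝ))
    split_ifs with ht
    · exact abs_pos.2 (coeff_Epos_ne_zero h h20 ht)
    · exact one_pos
  · intro a ha
    show aval S a = sgnR (decide (0 < (pdet dl S).coeff (Epos dl ord 0))) (posOf a ord) *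
      (if posOf a ord < 21 then |(pdet dl S).coeff (Epos dl ord (posOf a ord))| else (1 : ℝ))
    rw [if_pos (posOf_lt h ha), ← hcoef _ (posOf_lt h ha), coeff_Epos h hS (posOf_lt h ha),
      getD_posOf ((ordOK_spec h).2.2.1 a ha)]
  · intro t h1 h19; exact rowC25_of_twenty h h20 _ hx21 h1 h19
  · intro i j k hij hjk _; exact pval_G3 S hij hjk
  · intro i j _ _ hij hq; exact pval_RCS S hij hq
  · intro i j k l _ _ _ _ hij hik hil hjk hjl hkl; exact pval_W S hij hik hil hjk hjl hkl
  · intro i j k hij hjk _ hi hj hk; exact tri_pos S hij hjk hi hj hk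

/-- **Soundness of the cell checker**: a support whose two orientations carry accepted certificates has no
twenty — `ζ(2,6; d) ≤ 19`. [folklore] -/
theorem posRootLawOn_of_checkCell (dl : List ℕ) (cp cm : Cert) (hp : checkCell dl true cp = true)
    (hm : checkCell dl false cm = true) : PosRootLawOn 2 6 19 (fun i => dl.getD i 0) := by
  intro S hS
  by_contra hlt
  have h20 : 20 ≤ ((pdet dl S).roots.toFinset.filter (fun t => 0 < t)).card := by
    unfold pdet dfun; push Not at hlt; exact hlt
  unfold checkCell at hp hm
  simp only [Bool.and_eq_true] at hp hm
  obtain ⟨hord, hcp⟩ := hp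
  obtain ⟨-, hcm⟩ := hm
  obtain ⟨x, M⟩ := model_of_twenty hord hS h20
  by_cases hs : 0 < (pdet dl S).coeff (Epos dl (sortAtoms dl) 0)
  · rw [show decide (0 < (pdet dl S).coeff (Epos dl (sortAtoms dl) 0)) = true by simp [hs]] at M
    exact certOK_sound M hcp
  · rw [show decide (0 < (pdet dl S).coeff (Epos dl (sortAtoms dl) 0)) = false by simp [hs]] at M
    exact certOK_sound M hcm

/-- **Soundness of the table checker**: every key of an accepted table satisfies `ζ(2,6; d) ≤ 19`. [folklore] -/
theorem posRootLawOn_of_tableOK (keys : List (List ℕ)) (T : List Line) (h : tableOK keys T = true) :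
    ∀ d ∈ keys, PosRootLawOn 2 6 19 (fun i => d.getD i 0) := by
  unfold tableOK at h
  simp only [Bool.and_eq_true, decide_eq_true_eq, List.all_eq_true] at h
  obtain ⟨hkeys, hall⟩ := h
  intro d hd
  rw [← hkeys, List.mem_map] at hd
  obtain ⟨l, hl, rfl⟩ := hd
  obtain ⟨h1, h2⟩ := hall l hl
  exact posRootLawOn_of_checkCell l.1 l.2.1 l.2.2 h1 h2

/-! ### The box: enumeration by slices, Descartes fallback, mirror, cover -/

/-- Completeness of `incLists`. [folklore] -/
theorem mem_incLists : ∀ (n low hi : ℕ) (l : List ℕ), l.length = n → (∀ a ∈ l, low ≤ a ∧ a ≤ hi) →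
    l.Pairwise (· < ·) → l ∈ incLists n low hi
  | 0, _, _, [], _, _, _ => by simp [incLists]
  | 0, _, _, _ :: _, h, _, _ => by simp at h
  | _ + 1, _, _, [], h, _, _ => by simp at h
  | n + 1, low, hi, a :: l, hlen, hb, hpw => by
    rw [List.pairwise_cons] at hpw
    simp only [incLists, List.mem_flatMap, List.mem_map, List.mem_range'_1]
    refine ⟨a, ⟨(hb a (by simp)).1, by have := (hb a (by simp)).2; omega⟩, l, ?_, rfl⟩
    exact mem_incLists n (a + 1) hi l (by simpa using hlen)
      (fun x hx => ⟨hpw.1 x hx, (hb x (by simp [hx])).2⟩) hpw.2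

/-- The middle exponents of a sorted support are enumerated. [folklore] -/
theorem mem_incLists_three (d : Fin 6 → ℕ) (hd : StrictMono d) (h0 : d 0 = 0) :
    [d 1, d 2, d 3] ∈ incLists 3 1 (d 4 - 1) := by
  have h01 := hd (show (0 : Fin 6) < 1 by decide)
  have h12 := hd (show (1 : Fin 6) < 2 by decide)
  have h23 := hd (show (2 : Fin 6) < 3 by decide)
  have h34 := hd (show (3 : Fin 6) < 4 by decide)
  rw [h0] at h01
  refine mem_incLists 3 1 (d 4 - 1) _ rfl ?_ ?_
  · simp only [List.mem_cons, List.not_mem_nil, or_false, forall_eq_or_imp, forall_eq]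
    omega
  · have h13 : ([1, 2, 3] : List (Fin 6)).Pairwise (· < ·) := by decide
    exact h13.map d fun a b hab => hd hab

/-- `freshIn` means not a member. [folklore] -/
theorem freshIn_iff (a : ℕ) : ∀ l : List ℕ, freshIn a l = true ↔ a ∉ l
  | [] => by simp [freshIn]
  | b :: l => by
    rw [freshIn, Bool.and_eq_true, freshIn_iff a l, List.mem_cons, not_or]
    constructor
    · rintro ⟨h1, h2⟩
      refine ⟨fun e => ?_, h2⟩
      subst e; simp at h1
    · rintro ⟨h1, h2⟩
      refine ⟨?_, h2⟩
      have : Nat.beq b a = false := by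
        cases h : Nat.beq b a
        · rfl
        · exact absurd (Nat.eq_of_beq_eq_true h).symm h1
      simp [this]

/-- `distinctB` means `Nodup`. [folklore] -/
theorem distinctB_iff : ∀ l : List ℕ, distinctB l = true ↔ l.Nodup
  | [] => by simp [distinctB]
  | a :: l => by rw [distinctB, Bool.and_eq_true, distinctB_iff l, freshIn_iff, List.nodup_cons]

/-- Descartes fallback: a support with a repeated pair sum carries at most `19` positive roots. [folklore] -/
theorem posRootLawOn_of_not_sidon (d : Fin 6 → ℕ) (h : sidon [d 0, d 1, d 2, d 3, d 4, d 5] = false) :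
    PosRootLawOn 2 6 19 d := by
  classical
  intro S _
  refine posRoots_two_le_of_card_pairSums (by norm_num) _ ?_ S
  set dl : List ℕ := [d 0, d 1, d 2, d 3, d 4, d 5] with hdl
  have hps : psums6 dl = allAtoms.map (psum dl) := by rw [hdl]; rfl
  have hget : ∀ i : Fin 6, d i = dl.getD i.val 0 := by intro i; fin_cases i <;> rfl
  have hsub : (Finset.univ : Finset (Fin 6 × Fin 6)).image (fun p => d p.1 + d p.2)
      ⊆ (allAtoms.map (psum dl)).toFinset := by
    intro e he
    rw [Finset.mem_image] at he
    obtain ⟨p, -, rfl⟩ := he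
    rw [List.mem_toFinset, List.mem_map]
    exact ⟨cA p.1.val p.2.val, cA_mem p.1.isLt p.2.isLt, by rw [psum_cA, ← hget, ← hget]⟩
  have hnd : ¬ (allAtoms.map (psum dl)).Nodup := fun hn => by
    rw [sidon, hps, (distinctB_iff _).2 hn] at h; exact Bool.noConfusion h
  have hcard : (allAtoms.map (psum dl)).toFinset.card ≤ 20 := by
    rw [List.card_toFinset]
    have hsl := List.dedup_sublist (allAtoms.map (psum dl))
    have hle := hsl.length_le
    have hlen : (allAtoms.map (psum dl)).length = 21 := by simp [allAtoms]
    have hne : (allAtoms.map (psum dl)).dedup.length ≠ (allAtoms.map (psum dl)).length := by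
      intro heq
      have := hsl.eq_of_length heq
      exact hnd (this ▸ List.nodup_dedup _)
    omega
  exact (Finset.card_le_card hsub).trans hcard

/-- The mirror of a six-element support. [folklore] -/
theorem mirror_six (d : Fin 6 → ℕ) :
    (fun i : Fin 6 => (mirror [d 0, d 1, d 2, d 3, d 4, d 5]).getD i 0) = fun l => d 5 - d (Fin.rev l) := by
  funext i
  fin_cases i <;> simp [mirror]

/-- **Soundness of the cover by slices**: if a slice plan exhausts the box `d₅ ≤ N`, every slice passes the
cover check against the keys, and every key carries the row `ζ ≤ 19`, then every sorted support of the box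
carries it. [folklore] -/
theorem box_of_plan (N : ℕ) (P : List (ℕ × ℕ × ℕ)) (keys : List (List ℕ)) (hplan : planCovers N P = true)
    (hslices : coverSlices keys P = true) (hkeys : ∀ dl ∈ keys, PosRootLawOn 2 6 19 (fun i => dl.getD i 0))
    (d : Fin 6 → ℕ) (hd : StrictMono d) (h0 : d 0 = 0) (h5 : d 5 ≤ N) : PosRootLawOn 2 6 19 d := by
  have hdf : (fun i : Fin 6 => [d 0, d 1, d 2, d 3, d 4, d 5].getD i 0) = d := by
    funext i; fin_cases i <;> rfl
  have h01 := hd (show (0 : Fin 6) < 1 by decide)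
  have h12 := hd (show (1 : Fin 6) < 2 by decide)
  have h23 := hd (show (2 : Fin 6) < 3 by decide)
  have h34 := hd (show (3 : Fin 6) < 4 by decide)
  have h45 := hd (show (4 : Fin 6) < 5 by decide)
  unfold planCovers at hplan
  rw [List.all_eq_true] at hplan
  have hf := hplan (d 5) (List.mem_range.2 (by omega))
  rw [List.all_eq_true] at hf
  have he := hf (d 4) (List.mem_range.2 h45)
  have h4 : Nat.ble 4 (d 4) = true := by simp only [Nat.ble_eq]; omega
  rw [h4, Bool.not_true, Bool.false_or, List.any_eq_true] at he
  obtain ⟨s, hs, hsb⟩ := he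
  simp only [Bool.and_eq_true, beq_iff_eq, Nat.ble_eq] at hsb
  obtain ⟨⟨hs1, hs2⟩, hs3⟩ := hsb
  unfold coverSlices at hslices
  rw [List.all_eq_true] at hslices
  have hsl := hslices s hs
  unfold coverSlice at hsl
  rw [List.all_eq_true] at hsl
  have hrw := hsl (d 4) (List.mem_range'_1.2 ⟨hs2, by omega⟩)
  unfold coverRow at hrw
  rw [List.all_eq_true] at hrw
  have h := hrw _ (mem_incLists_three d hd h0)
  unfold coverCell at h
  rw [hs1] at h
  have hl : (0 :: ([d 1, d 2, d 3] ++ [d 4, d 5])) = [d 0, d 1, d 2, d 3, d 4, d 5] := by rw [h0]; rfl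
  rw [hl] at h
  simp only [Bool.or_eq_true, Bool.not_eq_true'] at h
  rcases h with (hsid | hk) | hm
  · exact posRootLawOn_of_not_sidon d hsid
  · rw [← hdf]
    exact hkeys _ (List.mem_of_mem_filter (List.mem_of_mem_filter (List.elem_iff.1 hk)))
  · have hrow := hkeys _ (List.mem_of_mem_filter (List.mem_of_mem_filter (List.elem_iff.1 hm)))
    rw [mirror_six] at hrow
    exact (posRootLawOn_iff_mirror_rev d (d 5) (fun l => hd.monotone (Fin.le_last l))).2 hrow

/-- `coverSlices` of a concatenated plan. [folklore] -/
theorem coverSlices_append (keys : List (List ℕ)) (A B : List (ℕ × ℕ × ℕ)) :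
    coverSlices keys (A ++ B) = (coverSlices keys A && coverSlices keys B) := by
  unfold coverSlices; rw [List.all_append]

end Main

end Summit.ValiantsHypothesis.ValiantsHypothesis.Theorems.LacunarySymmetroidMatrixDescartes.Census.V20
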